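import Mathlib
import Summits.Ventures.HodgeRepro.Tier4.Line4.PlaceIdemSet
import Summits.Ventures.HodgeRepro.Tier4.Common.PlaceCommute

/-!
# Tier4/Line4/PlacePart — the `S`-part and the away-from-`S` part of an adelic unitary element, `S` a set of finite
places; the subgroups `supportedOn S` / `trivialOn S`; the idempotence and commutation laws (C-L4-PSPLIT, Part A.1b)

Blind re-derivation cell `pub-hodge-repro`, Tier 4 «prove the step» (README §9–§10), seat t4-L2-p1 (gen 3; plan-4 g5's cut
C-L4-PSPLIT S15510, statement S15526 — generalised from one place `v` to a SET `S` of places, because the level sequence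
`p^n` shrinks the level at every place `v ∣ p`: the split of record is along `S = {v : v ∣ p}`).  Tree path
`lean/Summits/Ventures/HodgeRepro/Tier4/Line4/PlacePart.lean`; the idempotent calculus and the generic part are
`Line4/PlaceIdem.lean` / `Line4/PlaceIdemSet.lean`.  Definitions lane.  Imports `Common/PlaceCommute`
(`GA.ext_of_components`).  Mathlib-level; no literature.

THE PARTS.  `GA.ofPlacesPart W S := idemPart (1_S)` (components of `g` at the places of `S`, the identity elsewhere) and
`GA.offPlacesPart W S := idemPart (1 − 1_S)` (the identity at the places of `S` and at infinity, the components of `g`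
elsewhere); `g_f = g_S · g^{(S)}` (`ofPlacesPart_mul_offPlacesPart`, `= g` on `G(𝔸_f)`); the component laws
`finiteComponent_ofPlacesPart_of_mem / _of_notMem`, `finiteComponent_offPlacesPart_of_mem / _of_notMem`; the parts of a torus
element are torus elements (`ofPlacesPart_mem_torusT(')`, `offPlacesPart_mem_torusT(')`).
THE SUPPORT SUBGROUPS.  `supportedOn W S ≤ G(𝔸)` — trivial finite components off `S` and trivial archimedean components
(`G(k_S)`; `supportedOn_singleton : supportedOn {v} = atFinitePlace v`); `trivialOn W S ≤ G(𝔸)` — trivial finite components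
at the places of `S` (`trivialOn_singleton : trivialOn {v} = ker (finiteComponent v)`).  `ofPlacesPart_mem_supportedOn`,
`offPlacesPart_mem_trivialOn`, and the four IDEMPOTENCE LAWS `ofPlacesPart_eq_self_of_mem_supportedOn`,
`ofPlacesPart_eq_one_of_mem_trivialOn`, `offPlacesPart_eq_one_of_mem_supportedOn`, `offPlacesPart_eq_self_of_mem_trivialOn`
— the bijectivity of the split `T_f ≃ T_S × T_f^{(S)}` of `Line4/TorusFinSplit`; `commute_of_mem_supportedOn_of_mem_trivialOn`:
an element supported on `S` commutes with an element of `G(𝔸_f)` trivial on `S` (componentwise).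

Nothing here says anything about the status of the Hodge conjecture for CM abelian varieties, which is NOT proved
(HC_CM is NOT proved by anyone in this repository).
-/

set_option autoImplicit false
noncomputable section
namespace Summit.Ventures.HodgeRepro.Tier4.Line4
open Summit.Ventures.HodgeRepro.Tier4 Summit.Ventures.HodgeRepro.Tier4.Common
  Summit.Ventures.HodgeRepro.Tier4.Line1 NumberField IsDedekindDomain Matrix
open scoped NumberField Classical

section Places
variable {k : Type} [Field k] [NumberField k] (W : PlaneData k) (S : Set (HeightOneSpectrum (𝓞 k)))

/-- **The `S`-part of `g ∈ G(𝔸)`**, `S` a set of finite places: the element whose components at the places of `S` are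
those of `g` and whose every other component is the identity. -/
def GA.ofPlacesPart (g : GA W) : GA W := GA.idemPart W (setIdem k S) (setIdem_mul_self S) g

/-- **The away-from-`S` part of `g ∈ G(𝔸)`**: the element whose components at the places of `S` and at the archimedean
places are the identity and whose other finite components are those of `g`. -/
def GA.offPlacesPart (g : GA W) : GA W := GA.idemPart W (1 - setIdem k S) (one_sub_setIdem_mul_self S) g

/-- The matrix of the `S`-part. -/
theorem GA.mat_ofPlacesPart (g : GA W) :
    GA.mat W (GA.ofPlacesPart W S g) = mixM k 1 (atFinMS S (finM k (GA.mat W g))) := rfl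
/-- The matrix of the away part. -/
theorem GA.mat_offPlacesPart (g : GA W) :
    GA.mat W (GA.offPlacesPart W S g) = mixM k 1 (awayFinMS S (finM k (GA.mat W g))) := rfl

/-- The `S`-part of `1`. -/
theorem ofPlacesPart_one : GA.ofPlacesPart W S 1 = 1 := idemPart_one W (setIdem_mul_self S)
/-- The away part of `1`. -/
theorem offPlacesPart_one : GA.offPlacesPart W S 1 = 1 := idemPart_one W (one_sub_setIdem_mul_self S)
/-- The `S`-part is multiplicative. -/
theorem ofPlacesPart_mul (g h : GA W) : GA.ofPlacesPart W S (g * h) = GA.ofPlacesPart W S g * GA.ofPlacesPart W S h :=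
  idemPart_mul W (setIdem_mul_self S) g h
/-- The away part is multiplicative. -/
theorem offPlacesPart_mul (g h : GA W) :
    GA.offPlacesPart W S (g * h) = GA.offPlacesPart W S g * GA.offPlacesPart W S h :=
  idemPart_mul W (one_sub_setIdem_mul_self S) g h
/-- The `S`-part of an inverse. -/
theorem ofPlacesPart_inv (g : GA W) : GA.ofPlacesPart W S g⁻¹ = (GA.ofPlacesPart W S g)⁻¹ :=
  idemPart_inv W (setIdem_mul_self S) g
/-- The away part of an inverse. -/
theorem offPlacesPart_inv (g : GA W) : GA.offPlacesPart W S g⁻¹ = (GA.offPlacesPart W S g)⁻¹ :=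
  idemPart_inv W (one_sub_setIdem_mul_self S) g
/-- The `S`-part lies in `G(𝔸_f)`. -/
theorem ofPlacesPart_mem_finitePart (g : GA W) : GA.ofPlacesPart W S g ∈ finitePart W :=
  idemPart_mem_finitePart W (setIdem_mul_self S) g
/-- The away part lies in `G(𝔸_f)`. -/
theorem offPlacesPart_mem_finitePart (g : GA W) : GA.offPlacesPart W S g ∈ finitePart W :=
  idemPart_mem_finitePart W (one_sub_setIdem_mul_self S) g
/-- The `S`-part of a torus element is a torus element. -/
theorem ofPlacesPart_mem_torusT {g : GA W} (hg : g ∈ torusT W) : GA.ofPlacesPart W S g ∈ torusT W :=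
  idemPart_mem_torusT W (setIdem_mul_self S) hg
/-- The away part of a torus element is a torus element. -/
theorem offPlacesPart_mem_torusT {g : GA W} (hg : g ∈ torusT W) : GA.offPlacesPart W S g ∈ torusT W :=
  idemPart_mem_torusT W (one_sub_setIdem_mul_self S) hg
/-- The `S`-part of a `T′`-element is a `T′`-element. -/
theorem ofPlacesPart_mem_torusT' {g : GA W} (hg : g ∈ torusT' W) : GA.ofPlacesPart W S g ∈ torusT' W :=
  idemPart_mem_torusT' W (setIdem_mul_self S) hg
/-- The away part of a `T′`-element is a `T′`-element. -/
theorem offPlacesPart_mem_torusT' {g : GA W} (hg : g ∈ torusT' W) : GA.offPlacesPart W S g ∈ torusT' W :=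
  idemPart_mem_torusT' W (one_sub_setIdem_mul_self S) hg
/-- The `S`-part is continuous. -/
theorem continuous_ofPlacesPart : Continuous (GA.ofPlacesPart W S) :=
  continuous_idemPart W (setIdem_mul_self S)
/-- The away part is continuous. -/
theorem continuous_offPlacesPart : Continuous (GA.offPlacesPart W S) :=
  continuous_idemPart W (one_sub_setIdem_mul_self S)

/-- **`g_f = g_S · g^{(S)}`**: the `S`-part times the away part is the finite part. -/
theorem ofPlacesPart_mul_offPlacesPart (g : GA W) :
    GA.ofPlacesPart W S g * GA.offPlacesPart W S g = GA.ofFinPart W g := by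
  apply Subtype.ext
  apply Units.ext
  change GA.mat W (GA.ofPlacesPart W S g) * GA.mat W (GA.offPlacesPart W S g) = GA.mat W (GA.ofFinPart W g)
  rw [GA.mat_ofPlacesPart, GA.mat_offPlacesPart, GA.mat_ofFinPart]
  apply M4_ext
  · simp only [infM_mul, infM_mixM, Matrix.one_mul]
  · simp only [finM_mul, finM_mixM, atFinMS_mul_awayFinMS]

/-- `g = g_S · g^{(S)}` for `g ∈ G(𝔸_f)`. -/
theorem ofPlacesPart_mul_offPlacesPart_of_mem {g : GA W} (hg : g ∈ finitePart W) :
    GA.ofPlacesPart W S g * GA.offPlacesPart W S g = g := by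
  rw [ofPlacesPart_mul_offPlacesPart, ofFinPart_eq_self_of_mem_finitePart W hg]


/-- The `w`-component of the `S`-part, `w ∉ S`, is the identity. -/
theorem finiteComponent_ofPlacesPart_of_notMem {w : HeightOneSpectrum (𝓞 k)} (hw : w ∉ S) (g : GA W) :
    GA.finiteComponent W w (GA.ofPlacesPart W S g) = 1 := by
  rw [finiteComponent_eq_one_iff]
  intro i j
  show finM k (GA.mat W (GA.ofPlacesPart W S g)) i j w = _
  rw [GA.mat_ofPlacesPart, finM_mixM, atFinMS_apply_apply, if_neg hw, one_M4f_apply_apply]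

/-- The `w`-component of the `S`-part, `w ∈ S`, is the `w`-component. -/
theorem finiteComponent_ofPlacesPart_of_mem {w : HeightOneSpectrum (𝓞 k)} (hw : w ∈ S) (g : GA W) :
    GA.finiteComponent W w (GA.ofPlacesPart W S g) = GA.finiteComponent W w g := by
  apply Units.ext
  apply Matrix.ext
  intro i j
  rw [GA.finiteComponent_apply, GA.finiteComponent_apply]
  show finM k (GA.mat W (GA.ofPlacesPart W S g)) i j w = finM k (GA.mat W g) i j w
  rw [GA.mat_ofPlacesPart, finM_mixM, atFinMS_apply_apply, if_pos hw]

/-- The `w`-component of the away part, `w ∈ S`, is the identity. -/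
theorem finiteComponent_offPlacesPart_of_mem {w : HeightOneSpectrum (𝓞 k)} (hw : w ∈ S) (g : GA W) :
    GA.finiteComponent W w (GA.offPlacesPart W S g) = 1 := by
  rw [finiteComponent_eq_one_iff]
  intro i j
  show finM k (GA.mat W (GA.offPlacesPart W S g)) i j w = _
  rw [GA.mat_offPlacesPart, finM_mixM, awayFinMS_apply_apply, if_pos hw, one_M4f_apply_apply]

/-- The `w`-component of the away part, `w ∉ S`, is the `w`-component. -/
theorem finiteComponent_offPlacesPart_of_notMem {w : HeightOneSpectrum (𝓞 k)} (hw : w ∉ S) (g : GA W) :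
    GA.finiteComponent W w (GA.offPlacesPart W S g) = GA.finiteComponent W w g := by
  apply Units.ext
  apply Matrix.ext
  intro i j
  rw [GA.finiteComponent_apply, GA.finiteComponent_apply]
  show finM k (GA.mat W (GA.offPlacesPart W S g)) i j w = finM k (GA.mat W g) i j w
  rw [GA.mat_offPlacesPart, finM_mixM, awayFinMS_apply_apply, if_neg hw]

end Places

section Support
variable {k : Type} [Field k] [NumberField k] (W : PlaneData k) (S : Set (HeightOneSpectrum (𝓞 k)))

/-- **The elements supported on `S`**: trivial finite components off `S`, trivial archimedean components
(`G(k_S) := ∏_{v ∈ S} G(k_v)` embedded in `G(𝔸)`). -/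
def supportedOn : Subgroup (GA W) where
  carrier := {g | (∀ w, w ∉ S → GA.finiteComponent W w g = 1) ∧ ∀ w : InfinitePlace k, GA.infiniteComponent W w g = 1}
  one_mem' := ⟨fun _ _ => map_one _, fun _ => map_one _⟩
  mul_mem' := by
    rintro g h ⟨hg1, hg2⟩ ⟨hh1, hh2⟩
    exact ⟨fun w hw => by rw [map_mul, hg1 w hw, hh1 w hw, one_mul],
      fun w => by rw [map_mul, hg2 w, hh2 w, one_mul]⟩
  inv_mem' := by
    rintro g ⟨hg1, hg2⟩
    exact ⟨fun w hw => by rw [map_inv, hg1 w hw, inv_one], fun w => by rw [map_inv, hg2 w, inv_one]⟩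

/-- Membership in `supportedOn`. -/
theorem mem_supportedOn (g : GA W) : g ∈ supportedOn W S ↔
    (∀ w, w ∉ S → GA.finiteComponent W w g = 1) ∧ ∀ w : InfinitePlace k, GA.infiniteComponent W w g = 1 := Iff.rfl

/-- `supportedOn {v}` is `atFinitePlace v`. -/
theorem supportedOn_singleton (v : HeightOneSpectrum (𝓞 k)) : supportedOn W {v} = atFinitePlace W v := by
  ext g
  rw [mem_supportedOn]
  show _ ↔ (∀ v' : HeightOneSpectrum (𝓞 k), v' ≠ v → GA.finiteComponent W v' g = 1) ∧ _
  simp only [Set.mem_singleton_iff]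

/-- `supportedOn S ≤ G(𝔸_f)`. -/
theorem supportedOn_le_finitePart : supportedOn W S ≤ finitePart W := fun g hg => (mem_finitePart W g).2 hg.2

/-- **The elements trivial on `S`**: trivial finite components at the places of `S`. -/
def trivialOn : Subgroup (GA W) where
  carrier := {g | ∀ w, w ∈ S → GA.finiteComponent W w g = 1}
  one_mem' := fun _ _ => map_one _
  mul_mem' := by
    intro g h hg hh w hw
    rw [map_mul, hg w hw, hh w hw, one_mul]
  inv_mem' := by
    intro g hg w hw
    rw [map_inv, hg w hw, inv_one]

/-- Membership in `trivialOn`. -/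
theorem mem_trivialOn (g : GA W) : g ∈ trivialOn W S ↔ ∀ w, w ∈ S → GA.finiteComponent W w g = 1 := Iff.rfl

/-- `trivialOn {v}` is the kernel of the `v`-component. -/
theorem trivialOn_singleton (v : HeightOneSpectrum (𝓞 k)) : trivialOn W {v} = (GA.finiteComponent W v).ker := by
  ext g
  rw [mem_trivialOn, MonoidHom.mem_ker]
  simp only [Set.mem_singleton_iff, forall_eq]

/-- The `S`-part is supported on `S`. -/
theorem ofPlacesPart_mem_supportedOn (g : GA W) : GA.ofPlacesPart W S g ∈ supportedOn W S :=
  ⟨fun _ hw => finiteComponent_ofPlacesPart_of_notMem W S hw g,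
    (mem_finitePart W _).1 (ofPlacesPart_mem_finitePart W S g)⟩

/-- The away part is trivial on `S`. -/
theorem offPlacesPart_mem_trivialOn (g : GA W) : GA.offPlacesPart W S g ∈ trivialOn W S :=
  fun _ hw => finiteComponent_offPlacesPart_of_mem W S hw g

/-- The finite matrix of an element supported on `S` is the identity off `S`. -/
theorem finM_apply_apply_of_mem_supportedOn {g : GA W} (hg : g ∈ supportedOn W S) {w : HeightOneSpectrum (𝓞 k)}
    (hw : w ∉ S) (i j : Fin 4) : finM k (GA.mat W g) i j w = (1 : M4f k) i j w := by
  rw [one_M4f_apply_apply, finM_apply_apply]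
  exact (finiteComponent_eq_one_iff W w g).1 (hg.1 w hw) i j

/-- The finite matrix of an element trivial on `S` is the identity on `S`. -/
theorem finM_apply_apply_of_mem_trivialOn {g : GA W} (hg : g ∈ trivialOn W S) {w : HeightOneSpectrum (𝓞 k)}
    (hw : w ∈ S) (i j : Fin 4) : finM k (GA.mat W g) i j w = (1 : M4f k) i j w := by
  rw [one_M4f_apply_apply, finM_apply_apply]
  exact (finiteComponent_eq_one_iff W w g).1 (hg w hw) i j

/-- An element supported on `S` is its own `S`-part. -/
theorem ofPlacesPart_eq_self_of_mem_supportedOn {g : GA W} (hg : g ∈ supportedOn W S) :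
    GA.ofPlacesPart W S g = g := by
  apply Subtype.ext
  apply Units.ext
  change GA.mat W (GA.ofPlacesPart W S g) = GA.mat W g
  rw [GA.mat_ofPlacesPart]
  apply M4_ext
  · rw [infM_mixM, (mem_finitePart_iff_infM W g).1 (supportedOn_le_finitePart W S hg)]
  · rw [finM_mixM]
    exact atFinMS_eq_self_of_forall_notMem S fun w hw i j => finM_apply_apply_of_mem_supportedOn W S hg hw i j

/-- An element trivial on `S` has `S`-part `1`. -/
theorem ofPlacesPart_eq_one_of_mem_trivialOn {g : GA W} (hg : g ∈ trivialOn W S) : GA.ofPlacesPart W S g = 1 := by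
  apply Subtype.ext
  apply Units.ext
  change GA.mat W (GA.ofPlacesPart W S g) = (1 : M4 k)
  rw [GA.mat_ofPlacesPart]
  apply M4_ext
  · rw [infM_mixM, infM_one]
  · rw [finM_mixM, finM_one]
    exact atFinMS_eq_one_of_forall_mem S fun w hw i j => finM_apply_apply_of_mem_trivialOn W S hg hw i j

/-- An element supported on `S` has away part `1`. -/
theorem offPlacesPart_eq_one_of_mem_supportedOn {g : GA W} (hg : g ∈ supportedOn W S) :
    GA.offPlacesPart W S g = 1 := by
  apply Subtype.ext
  apply Units.ext
  change GA.mat W (GA.offPlacesPart W S g) = (1 : M4 k)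
  rw [GA.mat_offPlacesPart]
  apply M4_ext
  · rw [infM_mixM, infM_one]
  · rw [finM_mixM, finM_one]
    exact awayFinMS_eq_one_of_forall_notMem S fun w hw i j => finM_apply_apply_of_mem_supportedOn W S hg hw i j

/-- An element of `G(𝔸_f)` trivial on `S` is its own away part. -/
theorem offPlacesPart_eq_self_of_mem_trivialOn {g : GA W} (hgf : g ∈ finitePart W) (hg : g ∈ trivialOn W S) :
    GA.offPlacesPart W S g = g := by
  apply Subtype.ext
  apply Units.ext
  change GA.mat W (GA.offPlacesPart W S g) = GA.mat W g
  rw [GA.mat_offPlacesPart]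
  apply M4_ext
  · rw [infM_mixM, (mem_finitePart_iff_infM W g).1 hgf]
  · rw [finM_mixM]
    exact awayFinMS_eq_self_of_forall_mem S fun w hw i j => finM_apply_apply_of_mem_trivialOn W S hg hw i j

/-- **An element supported on `S` commutes with an element of `G(𝔸_f)` trivial on `S`** (componentwise: at each place
one of the two factors is the identity). -/
theorem commute_of_mem_supportedOn_of_mem_trivialOn {g h : GA W} (hg : g ∈ supportedOn W S) (hh : h ∈ trivialOn W S)
    (hhf : h ∈ finitePart W) : g * h = h * g := by
  apply GA.ext_of_components
  · intro w
    rw [map_mul, map_mul, hg.2 w, (mem_finitePart W h).1 hhf w]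
  · intro w
    by_cases hw : w ∈ S
    · rw [map_mul, map_mul, hh w hw, mul_one, one_mul]
    · rw [map_mul, map_mul, hg.1 w hw, mul_one, one_mul]

end Support

end Summit.Ventures.HodgeRepro.Tier4.Line4

end
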